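import Summits.KontsevichZagierPeriods.KontsevichZagierPeriods.Theorems.LinRedNormalFormArrangementNormalFormSeparateTwoZeroWeights

/-!
# Vertical fibres over the base plane: the Tonelli dictionary in dimension three

(Line `janus-bands`, crux `ArrangementNormalForm`, stub `stub_separateThreeZero`, part `HITonelli`
of the termwise numerator split `separateThree_hI` under the rim condition.)

All domination mechanisms of `separateThree_hI` are FIBREWISE over the base point
`v ∈ Fin 2 → ℝ` (pole coordinate `w ∈ ℝ` vertical). This part provides the dictionary: the fibre
`fib Ω v = {w | (v, w) ∈ Ω}`, Tonelli over a base set (`lintegral_inter_cyl`), the resulting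
integrability criterion by a fibrewise bound (`integrableOn_of_fibre_bound`, registered as
`separateThree_tonelli`), the interval structure of open convex bounded fibres
(`eq_Ioo_of_isOpen_convex`), and the integrability of the base weight `‖v − v₀‖⁻¹` on the unit
ball of the base plane (`lintegral_inv_norm_ball_lt_top`, from `SepTwoZero.integrableOn_inv_abs_add`).
-/

noncomputable section

open Set MeasureTheory Filter Topology
open scoped ENNReal

namespace Summit.KontsevichZagierPeriods.ArrangementNormalForm.JanusBands

namespace SepThree

/-! ### Fibres and Tonelli -/

section Fibre

variable {α : Type*}

/-- The vertical fibre of `Ω ⊆ α × ℝ` over the base point `v`. -/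
def fib (Ω : Set (α × ℝ)) (v : α) : Set ℝ := {w | (v, w) ∈ Ω}

/-- Membership in a fibre. -/
@[simp] theorem mem_fib {Ω : Set (α × ℝ)} {v : α} {w : ℝ} : w ∈ fib Ω v ↔ (v, w) ∈ Ω := Iff.rfl

/-- Fibres are monotone in the set. -/
theorem fib_mono {Ω Ω' : Set (α × ℝ)} (h : Ω ⊆ Ω') (v : α) : fib Ω v ⊆ fib Ω' v :=
  fun _ hw => h hw

variable [MeasurableSpace α]

/-- Fibres of a measurable set are measurable. -/
theorem measurableSet_fib {Ω : Set (α × ℝ)} (hΩ : MeasurableSet Ω) (v : α) :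
    MeasurableSet (fib Ω v) :=
  measurable_prodMk_left hΩ

end Fibre

section Tonelli

variable {V : Type*} [MeasureSpace V]

/-- The fibre integral is a measurable function of the base point. -/
theorem measurable_fibre_lintegral {Ω : Set (V × ℝ)} (hΩ : MeasurableSet Ω)
    {Φ : V × ℝ → ℝ≥0∞} (hΦ : Measurable Φ) :
    Measurable fun v => ∫⁻ w in fib Ω v, Φ (v, w) := by
  have h : (fun v => ∫⁻ w in fib Ω v, Φ (v, w)) = fun v => ∫⁻ w, Ω.indicator Φ (v, w) := by
    funext v
    rw [← lintegral_indicator (measurableSet_fib hΩ v)]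
    refine lintegral_congr fun w => ?_
    by_cases hw : (v, w) ∈ Ω
    · rw [indicator_of_mem hw, indicator_of_mem (show w ∈ fib Ω v from hw)]
    · rw [indicator_of_notMem hw, indicator_of_notMem (show w ∉ fib Ω v from hw)]
  rw [h]
  exact (hΦ.indicator hΩ).lintegral_prod_right'

/-- **Tonelli over a base set**: the integral over `Ω ∩ (S × ℝ)` is the base integral over `S` of
the fibre integrals. -/
theorem lintegral_inter_cyl {Ω : Set (V × ℝ)} (hΩ : MeasurableSet Ω) {S : Set V}
    (hS : MeasurableSet S) {Φ : V × ℝ → ℝ≥0∞} (hΦ : Measurable Φ) :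
    ∫⁻ p in Ω ∩ Prod.fst ⁻¹' S, Φ p = ∫⁻ v in S, ∫⁻ w in fib Ω v, Φ (v, w) := by
  have hm : MeasurableSet (Ω ∩ Prod.fst ⁻¹' S) := hΩ.inter (measurable_fst hS)
  rw [← lintegral_indicator hm, Measure.volume_eq_prod,
    lintegral_prod _ (hΦ.indicator hm).aemeasurable, ← lintegral_indicator hS]
  refine lintegral_congr fun v => ?_
  by_cases hv : v ∈ S
  · simp only [indicator_of_mem hv]
    rw [← lintegral_indicator (measurableSet_fib hΩ v)]
    refine lintegral_congr fun w => ?_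
    by_cases hw : (v, w) ∈ Ω
    · rw [indicator_of_mem (show (v, w) ∈ Ω ∩ Prod.fst ⁻¹' S from ⟨hw, hv⟩),
        indicator_of_mem (show w ∈ fib Ω v from hw)]
    · rw [indicator_of_notMem (show (v, w) ∉ Ω ∩ Prod.fst ⁻¹' S from fun h => hw h.1),
        indicator_of_notMem (show w ∉ fib Ω v from hw)]
  · simp only [indicator_of_notMem hv]
    have h0 : ∀ w, (Ω ∩ Prod.fst ⁻¹' S).indicator Φ (v, w) = 0 := fun w =>
      indicator_of_notMem (show (v, w) ∉ Ω ∩ Prod.fst ⁻¹' S from fun h => hv h.2) _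
    simp only [h0, lintegral_zero]

/-- **Integrability by a fibrewise bound.** If the fibre integrals of `‖g‖` over the base set `S`
are bounded (a.e.) by a function with finite base integral, `g` is integrable on `Ω ∩ (S × ℝ)`. -/
theorem integrableOn_of_fibre_bound {Ω : Set (V × ℝ)} (hΩ : MeasurableSet Ω) {S : Set V}
    (hS : MeasurableSet S) {g : V × ℝ → ℝ} (hg : Measurable g) {G : V → ℝ≥0∞}
    (hbound : ∀ᵐ v ∂(volume.restrict S), ∫⁻ w in fib Ω v, ‖g (v, w)‖ₑ ≤ G v)
    (hG : ∫⁻ v in S, G v < ∞) : IntegrableOn g (Ω ∩ Prod.fst ⁻¹' S) := by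
  refine ⟨hg.aestronglyMeasurable, ?_⟩
  rw [hasFiniteIntegral_iff_enorm]
  calc ∫⁻ p in Ω ∩ Prod.fst ⁻¹' S, ‖g p‖ₑ = ∫⁻ v in S, ∫⁻ w in fib Ω v, ‖g (v, w)‖ₑ :=
        lintegral_inter_cyl hΩ hS hg.enorm
    _ ≤ ∫⁻ v in S, G v := lintegral_mono_ae hbound
    _ < ∞ := hG

/-- The fibre integrals of an integrable function have finite base integral. -/
theorem lintegral_fibre_lt_top {Ω : Set (V × ℝ)} (hΩ : MeasurableSet Ω) {S : Set V}
    (hS : MeasurableSet S) {g : V × ℝ → ℝ} (hg : Measurable g) (hint : IntegrableOn g Ω) :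
    ∫⁻ v in S, ∫⁻ w in fib Ω v, ‖g (v, w)‖ₑ < ∞ := by
  rw [← lintegral_inter_cyl hΩ hS hg.enorm]
  exact ((hint.mono_set inter_subset_left).2)

end Tonelli

/-! ### The interval structure of a fibre -/

/-- An open, convex, bounded, nonempty subset of `ℝ` is the open interval between its infimum and
its supremum. -/
theorem eq_Ioo_of_isOpen_convex {S : Set ℝ} (ho : IsOpen S) (hc : Convex ℝ S) (hb : BddBelow S)
    (ha : BddAbove S) (hne : S.Nonempty) : S = Ioo (sInf S) (sSup S) := by
  have hoc : S.OrdConnected := convex_iff_ordConnected.1 hc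
  ext x
  constructor
  · intro hx
    obtain ⟨ε, hε, hball⟩ := Metric.isOpen_iff.1 ho x hx
    have h1 : x - ε / 2 ∈ S := hball (by
      rw [Metric.mem_ball, Real.dist_eq, show x - ε / 2 - x = -(ε / 2) by ring, abs_neg,
        abs_of_pos (half_pos hε)]
      exact half_lt_self hε)
    have h2 : x + ε / 2 ∈ S := hball (by
      rw [Metric.mem_ball, Real.dist_eq, show x + ε / 2 - x = ε / 2 by ring, abs_of_pos (half_pos hε)]
      exact half_lt_self hε)
    exact ⟨(csInf_le hb h1).trans_lt (by linarith), (le_csSup ha h2).trans_lt' (by linarith)⟩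
  · rintro ⟨h1, h2⟩
    obtain ⟨a, haS, hax⟩ := exists_lt_of_csInf_lt hne h1
    obtain ⟨b, hbS, hxb⟩ := exists_lt_of_lt_csSup hne h2
    exact hoc.out haS hbS ⟨hax.le, hxb.le⟩

/-- Fibres of an open set are open. -/
theorem isOpen_fib {V : Type*} [TopologicalSpace V] {Ω : Set (V × ℝ)} (hΩ : IsOpen Ω) (v : V) :
    IsOpen (fib Ω v) :=
  hΩ.preimage (continuous_const.prodMk continuous_id)

/-- Fibres of a convex set are convex. -/
theorem convex_fib {V : Type*} [AddCommGroup V] [Module ℝ V] {Ω : Set (V × ℝ)} (hΩ : Convex ℝ Ω)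
    (v : V) : Convex ℝ (fib Ω v) := by
  intro w hw w' hw' a b ha hb hab
  have h := hΩ hw hw' ha hb hab
  simp only [Prod.smul_mk, Prod.mk_add_mk, ← add_smul, hab, one_smul] at h
  exact h

/-- Fibres of a set contained in the slab `|w| < R` are bounded intervals. -/
theorem fib_subset_Ioo {V : Type*} {Ω : Set (V × ℝ)} {R : ℝ} (hR : ∀ p ∈ Ω, |p.2| < R) (v : V) :
    fib Ω v ⊆ Ioo (-R) R := fun w hw => by
  have := hR (v, w) hw
  rw [abs_lt] at this
  exact this

/-- The length of a fibre in the slab `|w| < R` is at most `2R`. -/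
theorem volume_fib_le {V : Type*} {Ω : Set (V × ℝ)} {R : ℝ} (hR : ∀ p ∈ Ω, |p.2| < R) (v : V) :
    volume (fib Ω v) ≤ ENNReal.ofReal (2 * R) := by
  calc volume (fib Ω v) ≤ volume (Ioo (-R) R) := measure_mono (fib_subset_Ioo hR v)
    _ = ENNReal.ofReal (2 * R) := by rw [Real.volume_Ioo]; ring_nf

/-! ### The base weight `‖u‖⁻¹` on the base plane `Fin 2 → ℝ` -/

/-- The sup norm on `Fin 2 → ℝ` dominates half the `ℓ¹`-norm. -/
theorem abs_add_abs_le_two_mul_norm (u : Fin 2 → ℝ) : |u 0| + |u 1| ≤ 2 * ‖u‖ := by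
  have h0 : |u 0| ≤ ‖u‖ := by rw [← Real.norm_eq_abs]; exact norm_le_pi_norm u 0
  have h1 : |u 1| ≤ ‖u‖ := by rw [← Real.norm_eq_abs]; exact norm_le_pi_norm u 1
  linarith

/-- `‖u‖⁻¹ ≤ 2 (|u 0| + |u 1|)⁻¹` on `Fin 2 → ℝ`. -/
theorem inv_norm_le (u : Fin 2 → ℝ) : ‖u‖⁻¹ ≤ 2 * (|u 0| + |u 1|)⁻¹ := by
  by_cases hu : u = 0
  · subst hu; simp
  · have hn : 0 < ‖u‖ := norm_pos_iff.2 hu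
    have hs : 0 < |u 0| + |u 1| := by
      by_contra h
      push Not at h
      have h0 : u 0 = 0 := abs_eq_zero.1 (by linarith [abs_nonneg (u 0), abs_nonneg (u 1)])
      have h1 : u 1 = 0 := abs_eq_zero.1 (by linarith [abs_nonneg (u 0), abs_nonneg (u 1)])
      exact hu (funext fun i => by fin_cases i <;> assumption)
    rw [show ‖u‖⁻¹ = 1 / ‖u‖ from (one_div _).symm,
      show (2 : ℝ) * (|u 0| + |u 1|)⁻¹ = 2 / (|u 0| + |u 1|) from (div_eq_mul_inv _ _).symm,
      div_le_div_iff₀ hn hs]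
    linarith [abs_add_abs_le_two_mul_norm u]

/-- The unit ball of `Fin 2 → ℝ` read in `ℝ × ℝ` lies in the open unit square. -/
theorem finTwoArrow_ball_subset :
    (MeasurableEquiv.finTwoArrow (α := ℝ)).symm ⁻¹' Metric.ball (0 : Fin 2 → ℝ) 1 ⊆
      Ioo (-1 : ℝ) 1 ×ˢ Ioo (-1 : ℝ) 1 := by
  intro w hw
  rw [mem_preimage, Metric.mem_ball, dist_zero_right] at hw
  have h0 : |w.1| < 1 := by
    have := norm_le_pi_norm ((MeasurableEquiv.finTwoArrow (α := ℝ)).symm w) 0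
    rw [Real.norm_eq_abs] at this
    exact this.trans_lt hw
  have h1 : |w.2| < 1 := by
    have := norm_le_pi_norm ((MeasurableEquiv.finTwoArrow (α := ℝ)).symm w) 1
    rw [Real.norm_eq_abs] at this
    exact this.trans_lt hw
  rw [abs_lt] at h0 h1
  exact ⟨⟨h0.1, h0.2⟩, ⟨h1.1, h1.2⟩⟩

/-- **The base weight is integrable**: `∫ ‖u‖⁻¹ du` over the unit ball of `Fin 2 → ℝ` is finite. -/
theorem lintegral_inv_norm_unitBall_lt_top :
    ∫⁻ u in Metric.ball (0 : Fin 2 → ℝ) 1, ENNReal.ofReal ‖u‖⁻¹ < ∞ := by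
  set e := (MeasurableEquiv.finTwoArrow (α := ℝ)).symm with he
  have hmp : MeasurePreserving e volume volume :=
    (volume_preserving_finTwoArrow ℝ).symm MeasurableEquiv.finTwoArrow
  have key : ∫⁻ u in Metric.ball (0 : Fin 2 → ℝ) 1, ENNReal.ofReal ‖u‖⁻¹ =
      ∫⁻ w in e ⁻¹' Metric.ball (0 : Fin 2 → ℝ) 1, ENNReal.ofReal ‖e w‖⁻¹ :=
    (hmp.setLIntegral_comp_preimage_emb e.measurableEmbedding
      (fun u => ENNReal.ofReal ‖u‖⁻¹) _).symm
  rw [key]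
  have hfin := (SepTwoZero.integrableOn_inv_abs_add).2
  rw [hasFiniteIntegral_iff_enorm] at hfin
  calc ∫⁻ w in e ⁻¹' Metric.ball (0 : Fin 2 → ℝ) 1, ENNReal.ofReal ‖e w‖⁻¹
      ≤ ∫⁻ w in Ioo (-1 : ℝ) 1 ×ˢ Ioo (-1 : ℝ) 1, ENNReal.ofReal ‖e w‖⁻¹ :=
        lintegral_mono_set finTwoArrow_ball_subset
    _ ≤ ∫⁻ w in Ioo (-1 : ℝ) 1 ×ˢ Ioo (-1 : ℝ) 1, 2 * ‖(|w.1| + |w.2|)⁻¹‖ₑ := by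
        refine lintegral_mono fun w => ?_
        have h := inv_norm_le (e w)
        have h0 : (e w) 0 = w.1 := by simp [he, MeasurableEquiv.finTwoArrow]
        have h1 : (e w) 1 = w.2 := by simp [he, MeasurableEquiv.finTwoArrow]
        rw [h0, h1] at h
        rw [Real.enorm_eq_ofReal_abs, abs_of_nonneg (by positivity),
          show (2 : ℝ≥0∞) = ENNReal.ofReal 2 by simp, ← ENNReal.ofReal_mul (by norm_num)]
        exact ENNReal.ofReal_le_ofReal h
    _ = 2 * ∫⁻ w in Ioo (-1 : ℝ) 1 ×ˢ Ioo (-1 : ℝ) 1, ‖(|w.1| + |w.2|)⁻¹‖ₑ := by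
        rw [lintegral_const_mul' _ _ (by simp)]
    _ < ∞ := ENNReal.mul_lt_top (by simp) hfin

/-- **The translated and shrunk base weight is integrable**: for `r ≤ 1`,
`∫_{‖v - v₀‖ < r} ‖v − v₀‖⁻¹ dv < ∞`. -/
theorem lintegral_inv_norm_ball_lt_top (v₀ : Fin 2 → ℝ) {r : ℝ} (hr : r ≤ 1) :
    ∫⁻ v in Metric.ball v₀ r, ENNReal.ofReal ‖v - v₀‖⁻¹ < ∞ := by
  have hmp : MeasurePreserving (fun v : Fin 2 → ℝ => v - v₀) volume volume :=
    measurePreserving_sub_right volume v₀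
  have hemb : MeasurableEmbedding (fun v : Fin 2 → ℝ => v - v₀) :=
    (Homeomorph.subRight v₀).measurableEmbedding
  have hpre : (fun v : Fin 2 → ℝ => v - v₀) ⁻¹' Metric.ball 0 1 = Metric.ball v₀ 1 := by
    ext v; simp [dist_eq_norm]
  have key := hmp.setLIntegral_comp_preimage_emb hemb (fun u => ENNReal.ofReal ‖u‖⁻¹)
    (Metric.ball 0 1)
  rw [hpre] at key
  calc ∫⁻ v in Metric.ball v₀ r, ENNReal.ofReal ‖v - v₀‖⁻¹
      ≤ ∫⁻ v in Metric.ball v₀ 1, ENNReal.ofReal ‖v - v₀‖⁻¹ :=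
        lintegral_mono_set (Metric.ball_subset_ball hr)
    _ = ∫⁻ u in Metric.ball (0 : Fin 2 → ℝ) 1, ENNReal.ofReal ‖u‖⁻¹ := key
    _ < ∞ := lintegral_inv_norm_unitBall_lt_top

end SepThree

/-- **Integrability by a fibrewise bound** (registered part of `stub_separateThreeZero`; literal
form of `SepThree.integrableOn_of_fibre_bound`): if the vertical fibre integrals of `‖g‖` over a
measurable base set `S` are a.e. bounded by a function with finite base integral, then `g` is
integrable on `Ω ∩ (S × ℝ)`. -/
theorem separateThree_tonelli {V : Type*} [MeasureTheory.MeasureSpace V] (Ω : Set (V × ℝ)) (hΩ : MeasurableSet Ω) (S : Set V) (hS : MeasurableSet S) (g : V × ℝ → ℝ) (hg : Measurable g) (G : V → ENNReal) (hbound : ∀ᵐ v ∂(MeasureTheory.volume.restrict S), MeasureTheory.lintegral (MeasureTheory.volume.restrict {w : ℝ | (v, w) ∈ Ω}) (fun w => ‖g (v, w)‖ₑ) ≤ G v) (hG : MeasureTheory.lintegral (MeasureTheory.volume.restrict S) G < ⊤) : MeasureTheory.IntegrableOn g (Ω ∩ Prod.fst ⁻¹' S) := by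
  exact SepThree.integrableOn_of_fibre_bound hΩ hS hg hbound hG

end Summit.KontsevichZagierPeriods.ArrangementNormalForm.JanusBands
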